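import Mathlib

/-!
# Clause 13-J/13-R, brick n3 LAYER D (GLUING ALGEBRA, monotonicity): the common-shape coefficients are monotone in the kernel constants

Route `FilamentSkeletonRss`, ∃-side clause 13 (`Clause13RNearStraightL` stmt-NavierStokesRegularity-23612; typing-agnostic); companion of
`…Clause13ModelGluingAlgebra` (p706422).  The coefficients `α_s, δ_s` produced by `window_piece_shape`, `band_piece_shape`, `low_piece_shape`,
`far_piece_shape` are polynomials / rational functions of the kernel `L¹` moments (`‖k‖₁, ‖t k‖₁, ‖k′‖₁, ‖t k′‖₁, …`) with NONNEGATIVE coefficients,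
hence monotone in each of them.  This lets the gluing theorem be stated with UPPER BOUNDS `∫|k| ≤ K, …` on the moments (the only form available for
kernels that are differences of scaled mother kernels) instead of their exact values:
`window_shape_mono`, `band_shape_mono`, `low_shape_mono`, `far_shape_mono`.  Pure real arithmetic.
Lane ns-filament-19175-p1 g17; `--supports stmt-NavierStokesRegularity-23612 --as helper`.
HONEST FRAMING: arithmetic bookkeeping for helper lemmas about an explicit 1-D model operator attached to a HYPOTHETICAL filament skeleton on the
NEGATIVE side of a MODEL route; nothing here bears on Navier–Stokes regularity or blow-up.
-/

noncomputable section

namespace Summit.NavierStokesRegularity.NavierStokesRegularity.Theorems.MatchedKernel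
set_option linter.dupNamespace false

/-- **Window-type coefficients are monotone** in `(K, K₁, K′, K′₁)`. [folklore] -/
theorem window_shape_mono {G κ Λ L₁ L₂ b₁ b₂ R nL nY K K₁ K' K'₁ Kb Kb₁ Kb' Kb'₁ : ℝ} (hG : 0 < G) (hκ : 0 < κ) (hΛ : 0 ≤ Λ)
    (hL₁ : 0 ≤ L₁) (hL₂ : 0 ≤ L₂) (hb₁ : 0 ≤ b₁) (hb₂ : 0 ≤ b₂) (hR : 0 ≤ R) (hnL : 0 ≤ nL) (hnY : 0 ≤ nY)
    (hK : 0 ≤ K) (hK₁ : 0 ≤ K₁) (hK' : 0 ≤ K') (hK'₁ : 0 ≤ K'₁) (eK : K ≤ Kb) (eK₁ : K₁ ≤ Kb₁) (eK' : K' ≤ Kb') (eK'₁ : K'₁ ≤ Kb'₁) :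
    K ^ 2 / (G * κ) * (nL * nY)
        + ((Λ * (K'₁ + K) + (L₁ + L₂) * K₁ + (b₁ + b₂) * K + Real.sqrt 2 * Λ * K'₁) + Real.sqrt 2 * Λ * K' * R) * K / (G * κ) * nY ^ 2
      ≤ Kb ^ 2 / (G * κ) * (nL * nY)
        + ((Λ * (Kb'₁ + Kb) + (L₁ + L₂) * Kb₁ + (b₁ + b₂) * Kb + Real.sqrt 2 * Λ * Kb'₁) + Real.sqrt 2 * Λ * Kb' * R) * Kb / (G * κ) * nY ^ 2 := by
  have hKb : 0 ≤ Kb := hK.trans eK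
  have hKb₁ : 0 ≤ Kb₁ := hK₁.trans eK₁
  have hKb' : 0 ≤ Kb' := hK'.trans eK'
  have hKb'₁ : 0 ≤ Kb'₁ := hK'₁.trans eK'₁
  gcongr

/-- **Band coefficients are monotone** in `(K, K₁, C)`. [folklore] -/
theorem band_shape_mono {G σ₀ q R nL nY K K₁ C Kb Kb₁ Cb : ℝ} (hG : 0 < G) (hσ : 0 < σ₀) (hR : 0 ≤ R) (hnL : 0 ≤ nL) (hnY : 0 ≤ nY)
    (hK : 0 ≤ K) (hK₁ : 0 ≤ K₁) (hC : 0 ≤ C) (eK : K ≤ Kb) (eK₁ : K₁ ≤ Kb₁) (eC : C ≤ Cb) :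
    √q * (Real.sqrt 2 * (K * R + K₁)) * K / (G * σ₀) * (nL * nY) + √q * (Real.sqrt 2 * (K * R + K₁)) * C / (G * σ₀) * nY ^ 2
      ≤ √q * (Real.sqrt 2 * (Kb * R + Kb₁)) * Kb / (G * σ₀) * (nL * nY) + √q * (Real.sqrt 2 * (Kb * R + Kb₁)) * Cb / (G * σ₀) * nY ^ 2 := by
  have hKb : 0 ≤ Kb := hK.trans eK
  have hKb₁ : 0 ≤ Kb₁ := hK₁.trans eK₁
  have hCb : 0 ≤ Cb := hC.trans eC
  gcongr

/-- **S0 coefficients are monotone** in `(K, K₁, C)`. [folklore] -/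
theorem low_shape_mono {q θ g Λ b₁ b₂ R nL nY K K₁ C Kb Kb₁ Cb : ℝ} (hq : 0 < q) (hθ : 0 < θ) (hg : 0 < g) (hb₁ : 0 ≤ b₁) (hb₂ : 0 ≤ b₂)
    (hR : 0 ≤ R) (hnL : 0 ≤ nL) (hnY : 0 ≤ nY) (hK : 0 ≤ K) (hK₁ : 0 ≤ K₁) (hC : 0 ≤ C) (eK : K ≤ Kb) (eK₁ : K₁ ≤ Kb₁) (eC : C ≤ Cb) :
    q / θ ^ 2 * (2 / g) * K ^ 2 * (nL * nY)
        + (θ / (Real.pi * √q) * K ^ 2 * (2 * R) + q / θ ^ 2 * (2 / g * (C * K + (b₁ + b₂) * K ^ 2) + Λ ^ 2 / g ^ 2 * (2 * (K * R + K₁) ^ 2))) * nY ^ 2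
      ≤ q / θ ^ 2 * (2 / g) * Kb ^ 2 * (nL * nY)
        + (θ / (Real.pi * √q) * Kb ^ 2 * (2 * R) + q / θ ^ 2 * (2 / g * (Cb * Kb + (b₁ + b₂) * Kb ^ 2) + Λ ^ 2 / g ^ 2 * (2 * (Kb * R + Kb₁) ^ 2)))
          * nY ^ 2 := by
  have hKb : 0 ≤ Kb := hK.trans eK
  have hKb₁ : 0 ≤ Kb₁ := hK₁.trans eK₁
  have hCb : 0 ≤ Cb := hC.trans eC
  gcongr

/-- **FAR coefficients are monotone** in `(K, αT, δT, CF, RW)`. [folklore] -/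
theorem far_shape_mono {β₀ ε Λ ℓ cH η nL nY K αT δT CF RW Kb αTb δTb CFb RWb : ℝ} (hβ₀ : 0 < β₀) (hε : 0 ≤ ε) (hε1 : ε < 1) (hΛ : 0 ≤ Λ)
    (hℓ : 0 ≤ ℓ) (hcH : 0 ≤ cH) (hη : 0 < η) (hnL : 0 ≤ nL) (hnY : 0 ≤ nY) (hK : 0 ≤ K) (hαT : 0 ≤ αT) (hδT : 0 ≤ δT) (hCF : 0 ≤ CF)
    (hRW : 0 ≤ RW) (eK : K ≤ Kb) (eαT : αT ≤ αTb) (eδT : δT ≤ δTb) (eCF : CF ≤ CFb) (eRW : RW ≤ RWb) :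
    (1 + ε) ^ 2 * (1 + K) * ((1 + K) + Λ * αT / (2 * η)) / (β₀ * (1 - ε) ^ 2) * (nL * nY)
        + ((1 + ε) ^ 2 * (1 + K) * Λ * (δT / (2 * η) + η / 2) + (1 + ε) * (1 + K) * ((1 + ε) * CF + cH * (1 + K) + ℓ * Λ * RW))
            / (β₀ * (1 - ε) ^ 2) * nY ^ 2
      ≤ (1 + ε) ^ 2 * (1 + Kb) * ((1 + Kb) + Λ * αTb / (2 * η)) / (β₀ * (1 - ε) ^ 2) * (nL * nY)
        + ((1 + ε) ^ 2 * (1 + Kb) * Λ * (δTb / (2 * η) + η / 2) + (1 + ε) * (1 + Kb) * ((1 + ε) * CFb + cH * (1 + Kb) + ℓ * Λ * RWb))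
            / (β₀ * (1 - ε) ^ 2) * nY ^ 2 := by
  have hKb : 0 ≤ Kb := hK.trans eK
  have hCFb : 0 ≤ CFb := hCF.trans eCF
  have hαTb : 0 ≤ αTb := hαT.trans eαT
  have hδTb : 0 ≤ δTb := hδT.trans eδT
  have hRWb : 0 ≤ RWb := hRW.trans eRW
  have h1e : 0 < (1 - ε) ^ 2 := pow_pos (by linarith) 2
  have hden : 0 < β₀ * (1 - ε) ^ 2 := mul_pos hβ₀ h1e
  gcongr

/-- Monotonicity of a window-type error constant `C = Λ(K′₁+K) + (L₁+L₂)K₁` (the S0 one). [folklore] -/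
theorem lowC_mono {Λ L₁ L₂ K K₁ K'₁ Kb Kb₁ Kb'₁ : ℝ} (hΛ : 0 ≤ Λ) (hL₁ : 0 ≤ L₁) (hL₂ : 0 ≤ L₂) (eK : K ≤ Kb) (eK₁ : K₁ ≤ Kb₁)
    (eK'₁ : K'₁ ≤ Kb'₁) : Λ * (K'₁ + K) + (L₁ + L₂) * K₁ ≤ Λ * (Kb'₁ + Kb) + (L₁ + L₂) * Kb₁ := by
  gcongr

/-- Monotonicity of the band error constant `C = Λ((K′a₁+K′b₁) + (Ka+Kb)) + (L₁+L₂)(Ka₁+Kb₁) + (Λ+b₁+3b₂)(Ka+Kb)`. [folklore] -/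
theorem bandC_mono {Λ L₁ L₂ b₁ b₂ Ka Kb Ka1 Kb1 Kad1 Kbd1 Kab Kbb Ka1b Kb1b Kad1b Kbd1b : ℝ} (hΛ : 0 ≤ Λ) (hL₁ : 0 ≤ L₁) (hL₂ : 0 ≤ L₂)
    (hb₁ : 0 ≤ b₁) (hb₂ : 0 ≤ b₂) (e1 : Ka ≤ Kab) (e2 : Kb ≤ Kbb) (e3 : Ka1 ≤ Ka1b) (e4 : Kb1 ≤ Kb1b) (e5 : Kad1 ≤ Kad1b) (e6 : Kbd1 ≤ Kbd1b) :
    Λ * ((Kad1 + Kbd1) + (Ka + Kb)) + (L₁ + L₂) * (Ka1 + Kb1) + (Λ + b₁ + 3 * b₂) * (Ka + Kb)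
      ≤ Λ * ((Kad1b + Kbd1b) + (Kab + Kbb)) + (L₁ + L₂) * (Ka1b + Kb1b) + (Λ + b₁ + 3 * b₂) * (Kab + Kbb) := by
  gcongr

/-- Monotonicity of the far operator constant `CF = Λ₂(K′₂ + K₁) + (L₁+L₂)K₁`. [folklore] -/
theorem farCF_mono {Λ₂ L₁ L₂ K₁ K'₂ Kb₁ Kb'₂ : ℝ} (hΛ₂ : 0 ≤ Λ₂) (hL₁ : 0 ≤ L₁) (hL₂ : 0 ≤ L₂) (eK₁ : K₁ ≤ Kb₁) (eK'₂ : K'₂ ≤ Kb'₂) :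
    Λ₂ * (K'₂ + K₁) + (L₁ + L₂) * K₁ ≤ Λ₂ * (Kb'₂ + Kb₁) + (L₁ + L₂) * Kb₁ := by
  gcongr

/-- Monotonicity of the far weight constant `RW = R + √2(K R + K₁)`. [folklore] -/
theorem farRW_mono {R K K₁ Kb Kb₁ : ℝ} (hR : 0 ≤ R) (eK : K ≤ Kb) (eK₁ : K₁ ≤ Kb₁) :
    R + Real.sqrt 2 * (K * R + K₁) ≤ R + Real.sqrt 2 * (Kb * R + Kb₁) := by
  gcongr

/-- Transitivity helpers: `nH ≤ (1+K)nY`, `K ≤ K̄` ⟹ `nH ≤ (1+K̄)nY`; `nWH ≤ RW·nY`, `RW ≤ R̄W` ⟹ `nWH ≤ R̄W·nY`;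
`nLH ≤ (1+K)nL + ΛnT + CF·nY` ⟹ the same with bars. [folklore] -/
theorem far_atoms_mono {nY nL nT nH nWH nLH Λ K Kb RW RWb CF CFb : ℝ} (hnY : 0 ≤ nY) (hnL : 0 ≤ nL) (eK : K ≤ Kb) (eRW : RW ≤ RWb)
    (eCF : CF ≤ CFb) (hH : nH ≤ (1 + K) * nY) (hWH : nWH ≤ RW * nY) (hLH : nLH ≤ (1 + K) * nL + Λ * nT + CF * nY) :
    nH ≤ (1 + Kb) * nY ∧ nWH ≤ RWb * nY ∧ nLH ≤ (1 + Kb) * nL + Λ * nT + CFb * nY := by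
  refine ⟨hH.trans ?_, hWH.trans ?_, hLH.trans ?_⟩
  · gcongr
  · gcongr
  · gcongr

end Summit.NavierStokesRegularity.NavierStokesRegularity.Theorems.MatchedKernel

end
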